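import Summits.HodgeConjecture.HodgeConjecture.Theorems.Ring2HypothesesDescentMotivatedVariational
import Summits.HodgeConjecture.HodgeConjecture.Theorems.Ring2HypothesesDescentMotivatedPullbackLift
import Summits.HodgeConjecture.HodgeConjecture.Theorems.Ring2AbelianAllAndreLerayIdempotentFromLifts
import Literature.AlgebraicGeometry.Andre1996.HodgeClassesMotivatedAssembly
import HarnessLib

/-!
# Ring 2 hypotheses, descent face — ANDRÉ'S DEFORMATION THEOREM 0.5 OVER SMOOTH PROJECTIVE BASES IS A THEOREM OF THE
# TREE (fact-free), hence Théorème 0.6.2 (c2) modulo the pencil Lemmes 6.3.1–6.3.3 (c11, c12) ONLY, and the b05 rows of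
# `…MotivatedVariational` / `…VariationalPartieFixe` WITHOUT c24 / c17

research route conditional on HC_CM; not a corollary; Q11.4-sentence-2 already refuted in dim ≥ 3.
Cell `pub-hodge-ring2` (Hodge ladder STAGE 3), seat `ring2-b05` (binder row b05
`Ring2.Hypotheses.MotivatedImpliesAlgebraicAV`), gen 42. `HC_CM` — BY NAME `Theses.RankFourFaces.CMAbelianHodge`, never
restated — is a HYPOTHESIS (binder) in exactly one row (§4 (V9″)) and a CONCLUSION in (V6a″); nothing here proves a
case of the Hodge conjecture; row b05, `HC_AV`, `CompactAbelianPencilVHC` stay OPEN; the numbers «10 · 0» do not move.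

THE OBSERVATION. The tree's named fact `Andre1996_deformation` (André 1996 Thm. 0.5, global-class form; table row c24)
quantifies over smooth projective families `f : 𝒳 ⟶ S` over a REDUCED CONNECTED FINITE-TYPE base, and its kernel
derivation (gen 36, `Andre1996_deformation_holds_of_inputs`) still consumes Mumford's curve lemma (A0), Hironaka's
smooth compactification (A1) and Deligne's théorème de la partie fixe `deligne_globalInvariantCycles` (c17). But the
ONLY families along which the b05 axis and André's own proof of Thm. 0.6.2 deform are COMPACT PENCILS («le théorème 0.5
appliqué au cas particulier d'un pinceau compact de variétés abéliennes», §6.3 p. 33) — families over a smooth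
PROJECTIVE base with smooth projective total space. For these, §5.1 needs neither (A0), (A1) (no curve to draw, nothing
to compactify: `X̄ = 𝒳`) nor c17: the partie fixe over a smooth projective base is Deligne 1968 / Voisin II Thm. 4.18,
PROVED in the tree (`deligne1968_invariantClass_fromTotalSpace_holds`), and consumed here through ab-andre-2's kernel
identity `ker j_t^* = ker j_s^*` (`Ring2.AbelianAll.map_fiberι_eq_zero_iff_of_points`, a theorem). With the motivic
step (A3) of §5.1 — André's Thm. 0.4 in the form «a class of `𝒳` motivated on the fibre `X_{s₀}` has a MOTIVATED
representative modulo `ker j_{s₀}^*`», PROVED by gen 36 (`Andre1996_exists_motivated_of_motivated_pullback_holds`) — and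
Prop. 2.1 (ii) (gen 34, `Andre1996_motivatedClasses_pullback_holds`), Thm. 0.5 over smooth projective bases is three
lines: `A = A' + (A − A')`, `A'` motivated on `𝒳`, `A − A' ∈ ker j_{s₀}^* = ker j_s^*`, so `j_s^* A = j_s^* A'` is
motivated.

* §1 **`map_fiberι_mem_motivatedClasses_of_isSmoothProjective_base`** — THM. 0.5 FOR EVERY SMOOTH PROJECTIVE FAMILY
  OVER A SMOOTH PROJECTIVE BASE (any dimensions), fact-free; `compactPencil_map_fiberι_mem_motivatedClasses` — the
  compact-abelian-pencil case, i.e. the literature seat's `Andre1996.compactPencil_map_fiber_mem_motivatedClasses`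
  WITHOUT its binder `h05 : Andre1996_deformation`.
* §2 **THÉORÈME 0.6.2 (c2) MODULO LEMMES 6.3.1–6.3.3 ONLY**: `andre1996_hodgeClasses_abelianVariety_motivated_of_pencils'
  (h₁ : andre1996_cmAnchoredPencil) (h₂ : andre1996_cmHodgeClasses_algebraicallyAnchoredPencils) :
  Andre1996_hodgeClasses_abelianVariety_motivated` — the literature seat's assembly
  `Andre1996_hodgeClasses_abelianVariety_motivated_of_pencils` (c2 ⟸ c24 ∧ Prop. 2.1 (ii) ∧ c11 ∧ c12) re-run with §1
  in place of c24 (steps b), c) and a) of §6.3 adapted verbatim; Prop. 2.1 (ii) is gen 34's theorem). Before this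
  part the best kernel modulus of c2 was {c11, c12, c17} (gen 36 `…VariationalPartieFixe`).
* §3 THE b05 ROWS RE-KEYED (gen 30's (V2), (V3), (V6a–d), (V6d′) and gen 36's primed forms, with `hD : Andre1996_deformation`
  resp. `hGIC : deligne_globalInvariantCycles` DELETED): (V3″) **`MotivatedImpliesAlgebraicAV ⟹ CompactAbelianPencilVHC`
  FACT-FREE**; (V6a″) b05 ⟹ `HC_CM` mod {c12}; (V6b″) b05 ⟹ `HC_AV` mod {c11, c12}; (V6c″) b05 ⟹ `AbelianSchemeVHC` mod
  {c11, c12}; (V6d″) **`HC_AV ↔ MotivatedImpliesAlgebraicAV` mod {c11, c12}** — the dictionary cell «b05 ≡ HC_AV» with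
  the pencil lemmas as its whole modulus; (V6d′″) `MotivatedImpliesAlgebraicAV ↔ CompactAbelianPencilVHC` mod {c11, c12}
  (gen 30's (V6e) «b05 ⟹ c2» is superseded by §2, which needs no b05).
* §4 (V9″) **`HC_CM ∧ MotivatedImpliesAlgebraicAV ⟹ HC_AV` modulo Lemme 6.3.1 (c11) ALONE** (was {c11, c24} in gen 30,
  {c11, c17} in gen 36).

HONEST COLUMN. No node is discharged; c2, c11, c12 remain named facts (c2 is DERIVED from c11 ∧ c12, not proved);
`Andre1996_deformation` itself (arbitrary reduced connected finite-type base) is NOT proved here — only its restriction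
to smooth projective bases, which is all the b05 axis and §6.3 use; c17 / c24 / (A0) / (A1) leave the modulus of every
b05 row, they are not discharged. No definition, no named fact, no sorry; `HC_CM` by name only.
References: Andre1996Motifs (Thm. 0.4 p. 7, Thm. 0.5 p. 8, Thm. 0.6.2 p. 9, Prop. 2.1 pp. 14–15, §5.1 p. 25, §6.3
Lemmes 6.3.1–6.3.3 and Remarque 2 pp. 31–33), Deligne1968 ((2.1), (2.6.3)), VoisinHodgeII2003 (§4.3.1 Thm. 4.18),
DeligneHodgeII1971 (Thm. 4.1.1 — the general-base statement NOT used), Milne2020HodgeClassesAV (Rem. 2–3),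
Abdulali1994FamiliesAV ((1.1), Lemma 6.2).
-/

set_option linter.dupNamespace false

noncomputable section

open CategoryTheory AlgebraicGeometry
open Literature.AlgebraicGeometry Literature.AlgebraicGeometry.Motives
open Literature.AlgebraicGeometry.HodgeTheory
open Literature.AlgebraicGeometry.Milne1999 (IsOfCMType)
open Literature.AlgebraicGeometry.Andre1996 (andre1996_cmAnchoredPencil
  andre1996_cmHodgeClasses_algebraicallyAnchoredPencils IsAlgebraicallyAnchoredPencilFor compactPencil_dim_eq_of_iso)

/-! ## §1 Théorème 0.5 over a smooth projective base — fact-free -/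

namespace Summit.HodgeConjecture.HodgeConjecture.Theorems

/-- **ANDRÉ 1996, THÉORÈME 0.5 (deformation of motivated classes) FOR SMOOTH PROJECTIVE FAMILIES OVER SMOOTH PROJECTIVE
BASES, global-class form, UNCONDITIONALLY**: for `f : 𝒳 ⟶ S` a smooth projective family of relative dimension `n`
(`IsSmoothProjectiveFamily`) over a smooth projective base `S` (dimension `m`) with smooth projective total space `𝒳`
(dimension `N`), and a class `A ∈ H²ᵖ(𝒳(ℂ); ℂ)`: if `A|_{X_{s₀}}` is motivated for ONE complex point `s₀`, then `A|_{X_s}`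
is motivated for EVERY complex point `s`. Proof («§5.1 with `X̄ = 𝒳`»): by the motivic step (A3) = Thm. 0.4 (gen 36's
theorem `Andre1996_exists_motivated_of_motivated_pullback_holds`) there is a MOTIVATED `A'` on `𝒳` with
`j_{s₀}^* A' = j_{s₀}^* A`; `A − A' ∈ ker j_{s₀}^* = ker j_s^*` (Deligne's kernel identity over a smooth projective base,
ab-andre-2's theorem `map_fiberι_eq_zero_iff_of_points`, resting on the PROVED partie fixe Voisin II Thm. 4.18); and
`j_s^* A'` is motivated by Prop. 2.1 (ii) (gen 34's theorem `Andre1996_motivatedClasses_pullback_holds`). This is the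
restriction of the named fact `Andre1996_deformation` (c24) to smooth projective bases — the case André's §6.3 uses.
[cite: Andre1996Motifs, Thm. 0.5 (p. 8), §5.1 (p. 25) and Thm. 0.4 (p. 7)] [cite: VoisinHodgeII2003, §4.3.1 Thm. 4.18]
[cite: Deligne1968, (2.1) and (2.6.3)] -/
theorem map_fiberι_mem_motivatedClasses_of_isSmoothProjective_base {n m N : ℕ} {𝒳 S : SchemeOver ℂ} {f : 𝒳 ⟶ S}
    (hS : IsSmoothProjective m S) (hf : IsSmoothProjectiveFamily f n) (h𝒳 : IsSmoothProjective N 𝒳)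
    (p : ℕ) (A : complexBetti 𝒳 (2 * p)) (s₀ : ComplexPoints S)
    (h₀ : complexBetti.map (fiberι f s₀) (2 * p) A ∈ motivatedClasses n (fiberOver f s₀) p) (s : ComplexPoints S) :
    complexBetti.map (fiberι f s) (2 * p) A ∈ motivatedClasses n (fiberOver f s) p := by
  obtain ⟨A', hA', hj⟩ := Andre1996_exists_motivated_of_motivated_pullback_holds (fiberι f s₀) h𝒳
    (hf.isSmoothProjective s₀) p A h₀
  have hker : complexBetti.map (fiberι f s) (2 * p) (A - A') = 0 :=
    (Ring2.AbelianAll.map_fiberι_eq_zero_iff_of_points hS hf h𝒳 s₀ s (A - A')).1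
      (by rw [map_sub, hj, sub_self])
  rw [map_sub, sub_eq_zero] at hker
  rw [hker]
  exact Andre1996_motivatedClasses_pullback_holds (fiberι f s) h𝒳 (hf.isSmoothProjective s) p A' hA'

/-- **Théorème 0.5 «appliqué au cas particulier d'un pinceau compact de variétés abéliennes» (§6.3 p. 33), fact-free**:
on a compact pencil of abelian `d`-folds `f : 𝒳 ⟶ S` (base a smooth projective curve, total space a smooth projective
`(d+1)`-fold), a global class `W ∈ H²ᵖ(𝒳(ℂ); ℂ)` motivated on one fibre is motivated on every fibre — the literature
seat's `Andre1996.compactPencil_map_fiber_mem_motivatedClasses` with its binder `h05 : Andre1996_deformation` REMOVED.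
[cite: Andre1996Motifs, Thm. 0.5 (p. 8) and §6.3 (p. 33)] [cite: VoisinHodgeII2003, §4.3.1 Thm. 4.18] -/
theorem compactPencil_map_fiberι_mem_motivatedClasses {d : ℕ} {𝒳 S : SchemeOver ℂ} {f : 𝒳 ⟶ S}
    (hf : IsCompactAbelianPencil f d) (p : ℕ) (W : complexBetti 𝒳 (2 * p)) (s₀ : ComplexPoints S)
    (h₀ : complexBetti.map (fiberι f s₀) (2 * p) W ∈ motivatedClasses d (fiberOver f s₀) p) (s : ComplexPoints S) :
    complexBetti.map (fiberι f s) (2 * p) W ∈ motivatedClasses d (fiberOver f s) p :=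
  map_fiberι_mem_motivatedClasses_of_isSmoothProjective_base hf.isSmoothProjective_base hf.isSmoothProjectiveFamily
    hf.isSmoothProjective_total p W s₀ h₀ s

/-! ## §2 Théorème 0.6.2 (c2) modulo Lemmes 6.3.1–6.3.3 (c11, c12) only -/

/-- **Lemme 6.3.3 + Thm. 0.5 (§1) + Prop. 2.1 (ii) ⟹ the carried class is motivated** — the literature seat's
`IsAlgebraicallyAnchoredPencilFor.mem_motivatedClasses` without `h05` (and with Prop. 2.1 (ii) the theorem of gen 34):
if `w ∈ H^{2p}(B(ℂ); ℂ)` is carried by an algebraically anchored compact pencil then `w ∈ A_motᵖ(B)_ℂ`.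
-- adapted from Literature/AlgebraicGeometry/Andre1996/HodgeClassesMotivatedAssembly.lean
[cite: Andre1996Motifs, §6.3 c) and p. 33] -/
theorem mem_motivatedClasses_of_isAlgebraicallyAnchoredPencilFor {B : AbelianVariety ℂ} {p : ℕ}
    {w : complexBetti B.X (2 * p)} {𝒳 S : SchemeOver ℂ} {f : 𝒳 ⟶ S} {d : ℕ}
    (h : IsAlgebraicallyAnchoredPencilFor B p w f d) : w ∈ motivatedClasses B.dim B.X p := by
  obtain ⟨hf, s₁, s₀, W, A₁, e₁, g, q, hW, hq, hgw, h₀⟩ := h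
  -- the algebraic fibre value is motivated
  have h₀' : complexBetti.map (fiberι f s₀) (2 * p) W ∈ motivatedClasses d (fiberOver f s₀) p :=
    algebraicClasses_le_motivatedClasses_of_nonempty_hardLefschetzNFold_self
      (hf.isSmoothProjectiveFamily.isSmoothProjective s₀) (nonempty_hardLefschetzNFold_holds _ _) p h₀
  -- Thm. 0.5 along the pencil (§1, fact-free)
  have h₁ := compactPencil_map_fiberι_mem_motivatedClasses hf p W s₀ h₀' s₁
  -- across the chart `e₁ : A₁.X ≅ 𝒳_{s₁}`
  have hA₁ : IsSmoothProjective d A₁.X :=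
    (hf.isSmoothProjectiveFamily.isSmoothProjective s₁).of_iso e₁.symm
  have h₂ : complexBetti.map e₁.hom (2 * p) (complexBetti.map (fiberι f s₁) (2 * p) W) ∈
      motivatedClasses d A₁.X p :=
    (map_mem_motivatedClasses_iff_of_iso (hf.isSmoothProjectiveFamily.isSmoothProjective s₁) hA₁ e₁
      _).2 h₁
  -- back along `g : B ⟶ A₁` (Prop. 2.1 (ii), gen 34's theorem)
  have h₃ : (q : ℂ) • w ∈ motivatedClasses B.dim B.X p := by
    rw [← hgw]
    exact Andre1996_motivatedClasses_pullback_holds g.hom.hom.hom hA₁ AbelianVariety.isSmoothProjective_holds p _ h₂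
  exact (Submodule.smul_mem_iff _ (Rat.cast_ne_zero.2 hq)).1 h₃

/-- **Thm. 0.6.2 for abelian varieties of CM type, modulo Lemmes 6.3.2–6.3.3 (c12) only** — the literature seat's
`mem_motivatedClasses_of_isOfCMType` without `h05` / `hpb`: every rational `(p,p)` class on a complex abelian variety of
CM type is motivated (codimension `≤ 1`: algebraic, hence motivated; `p ≥ 2`: the span of Lemmes 6.3.2–6.3.3).
-- adapted from Literature/AlgebraicGeometry/Andre1996/HodgeClassesMotivatedAssembly.lean
[cite: Andre1996Motifs, §6.3 b), c) (pp. 32–33)] -/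
theorem mem_motivatedClasses_of_isOfCMType_of_pencils (h₂ : andre1996_cmHodgeClasses_algebraicallyAnchoredPencils)
    (B : AbelianVariety ℂ) (hB : IsSmoothProjective B.dim B.X) (hCM : IsOfCMType B) (p : ℕ)
    (c : complexBetti B.X (2 * p)) (hc : IsRationalClass c) (hpp : IsOfHodgeType B.dim B.X (2 * p) p p c) :
    c ∈ motivatedClasses B.dim B.X p := by
  have hAM := algebraicClasses_le_motivatedClasses_of_nonempty_hardLefschetzNFold_self hB
    (nonempty_hardLefschetzNFold_holds _ _)
  obtain _ | _ | p := p
  · exact hAM 0 (hodgeConjectureFor_codim_zero c)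
  · exact hAM 1 (lefschetzOneOne_rational_holds hB c hc hpp)
  · refine (Submodule.span_le.mpr ?_) (h₂ B hB hCM (p + 2) (by omega) c hc hpp)
    rintro _ ⟨B', g, w, d, 𝒳, S, f, hpencil, rfl⟩
    exact Andre1996_motivatedClasses_pullback_holds g.hom.hom.hom AbelianVariety.isSmoothProjective_holds hB (p + 2) _
      (mem_motivatedClasses_of_isAlgebraicallyAnchoredPencilFor hpencil)

/-- **ANDRÉ 1996, THÉORÈME 0.6.2 (c2) MODULO LEMMES 6.3.1–6.3.3 (c11, c12) ONLY**: granted Lemme 6.3.1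
(`andre1996_cmAnchoredPencil`) and Lemmes 6.3.2–6.3.3 (`andre1996_cmHodgeClasses_algebraicallyAnchoredPencils`), every
rational `(p,p)` class on every complex abelian variety is motivated — the tree's named fact
`Andre1996_hodgeClasses_abelianVariety_motivated`. The literature seat's assembly
`Andre1996_hodgeClasses_abelianVariety_motivated_of_pencils` with Thm. 0.5 supplied by §1 (fact-free) and Prop. 2.1 (ii)
by gen 34's theorem: step a) at the CM fibre `𝒳_t ≅ A₀.X` of Lemme 6.3.1's pencil, transported to `𝒳_s`, read on `A₁`
across the chart and pulled back along `g : A ⟶ A₁` to `q · c`, `q ≠ 0`. NOT a discharge of c2 (c11, c12 are named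
facts); the modulus {c11, c12, c17} of gen 36 loses c17.
-- adapted from Literature/AlgebraicGeometry/Andre1996/HodgeClassesMotivatedAssembly.lean
[cite: Andre1996Motifs, Thm. 0.6.2 (p. 9) and §6.3 (pp. 31–33)] [cite: VoisinHodgeII2003, §4.3.1 Thm. 4.18] -/
theorem andre1996_hodgeClasses_abelianVariety_motivated_of_pencils' (h₁ : andre1996_cmAnchoredPencil)
    (h₂ : andre1996_cmHodgeClasses_algebraicallyAnchoredPencils) :
    Andre1996_hodgeClasses_abelianVariety_motivated := by
  intro A hA p c hc hpp
  obtain ⟨𝒳, S, f, hf, s, t, W, A₁, A₀, e₁, g, q, hW, hq, hgc, ⟨e₀⟩, hCM₀⟩ := h₁ A hA p c hc hpp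
  -- the CM fibre `𝒳_t ≅ A₀.X`
  have hdim : A₀.dim = 2 * A.dim := compactPencil_dim_eq_of_iso hf e₀
  have hA₀ : IsSmoothProjective A₀.dim A₀.X := AbelianVariety.isSmoothProjective_holds
  have hA₀' : IsSmoothProjective (2 * A.dim) A₀.X := hdim ▸ hA₀
  have ht : IsSmoothProjective (2 * A.dim) (fiberOver f t) :=
    hf.isSmoothProjectiveFamily.isSmoothProjective t
  -- `W|_{𝒳_t}`, read on `A₀`, is a rational `(p,p)` class of the CM abelian variety `A₀`
  have hc₀ : IsRationalClass (complexBetti.map e₀.hom (2 * p) (complexBetti.map (fiberι f t) (2 * p) W)) :=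
    (isRationalClass_map_iff_of_iso e₀).2 (hW t).1
  have hpp₀ : IsOfHodgeType A₀.dim A₀.X (2 * p) p p
      (complexBetti.map e₀.hom (2 * p) (complexBetti.map (fiberι f t) (2 * p) W)) := by
    rw [hdim]
    exact (isOfHodgeType_map_iff_of_iso e₀).2 (hW t).2
  -- hence motivated (steps b), c)), and so is `W|_{𝒳_t}`
  have hmot₀ := mem_motivatedClasses_of_isOfCMType_of_pencils h₂ A₀ hA₀ hCM₀ p _ hc₀ hpp₀
  rw [hdim] at hmot₀
  have h₀ : complexBetti.map (fiberι f t) (2 * p) W ∈ motivatedClasses (2 * A.dim) (fiberOver f t) p :=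
    (map_mem_motivatedClasses_iff_of_iso ht hA₀' e₀ _).1 hmot₀
  -- Thm. 0.5 along the pencil, from `t` to `s` (§1, fact-free)
  have h₁' := compactPencil_map_fiberι_mem_motivatedClasses hf p W t h₀ s
  -- across `e₁ : A₁.X ≅ 𝒳_s` and back along `g : A ⟶ A₁`
  have hA₁ : IsSmoothProjective (2 * A.dim) A₁.X :=
    (hf.isSmoothProjectiveFamily.isSmoothProjective s).of_iso e₁.symm
  have h₂' : complexBetti.map e₁.hom (2 * p) (complexBetti.map (fiberι f s) (2 * p) W) ∈
      motivatedClasses (2 * A.dim) A₁.X p :=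
    (map_mem_motivatedClasses_iff_of_iso (hf.isSmoothProjectiveFamily.isSmoothProjective s) hA₁ e₁
      _).2 h₁'
  have h₃ : (q : ℂ) • c ∈ motivatedClasses A.dim A.X p := by
    rw [← hgc]
    exact Andre1996_motivatedClasses_pullback_holds g.hom.hom.hom hA₁ hA p _ h₂'
  exact (Submodule.smul_mem_iff _ (Rat.cast_ne_zero.2 hq)).1 h₃

end Summit.HodgeConjecture.HodgeConjecture.Theorems

/-! ## §3 The b05 rows of gen 30 / gen 36 re-keyed: Théorème 0.5 / partie fixe binders deleted -/

namespace Summit.HodgeConjecture.HodgeConjecture.Ring2.Hypotheses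

open Summit.HodgeConjecture.HodgeConjecture.Theorems (compactPencil_map_fiberι_mem_motivatedClasses
  andre1996_hodgeClasses_abelianVariety_motivated_of_pencils')

/-- **(V2″) Per compact pencil, transport of algebraicity granted row b05 ALONE** (gen 30's (V2) without
`hD : Andre1996_deformation`): a global class algebraic on ONE fibre of a compact pencil of abelian varieties is
algebraic on every fibre — algebraic ⟹ motivated at `s₀`, Thm. 0.5 (§1, fact-free) to `s`, row b05 on the abelian
fibre `𝒳_s`. No rationality / Hodge-type hypothesis. [cite: Andre1996Motifs, Thm. 0.5 (p. 8) and §6.3 (p. 33)]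
[cite: Milne2020HodgeClassesAV, Rem. 3] -/
theorem compactPencil_map_fiberι_mem_algebraicClasses_of_motivatedImpliesAlgebraicAV (h : MotivatedImpliesAlgebraicAV)
    {d : ℕ} {𝒳 S : SchemeOver ℂ} {f : 𝒳 ⟶ S} (hf : IsCompactAbelianPencil f d) (p : ℕ)
    (W : complexBetti 𝒳 (2 * p)) {s₀ : ComplexPoints S}
    (h₀ : complexBetti.map (fiberι f s₀) (2 * p) W ∈ algebraicClasses (fiberOver f s₀) p)
    (s : ComplexPoints S) :
    complexBetti.map (fiberι f s) (2 * p) W ∈ algebraicClasses (fiberOver f s) p := by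
  have h₀' : complexBetti.map (fiberι f s₀) (2 * p) W ∈ motivatedClasses d (fiberOver f s₀) p :=
    algebraicClasses_le_motivatedClasses_of_nonempty_hardLefschetzNFold_self
      (hf.isSmoothProjectiveFamily.isSmoothProjective s₀) (nonempty_hardLefschetzNFold_holds _ _) p h₀
  exact motivated_algebraic_of_abelian_fiber h hf.isSmoothProjectiveFamily (hf.exists_abelianVariety_fiber s) p
    (compactPencil_map_fiberι_mem_motivatedClasses hf p W s₀ h₀' s)

/-- **(V3″) `MotivatedImpliesAlgebraicAV ⟹ CompactAbelianPencilVHC`, FACT-FREE** (gen 30's (V3) granted Thm. 0.5, gen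
36's (V2′) granted c17 — now with NO named fact): row b05 sits above the deform seat's compact-pencil node in the
kernel outright. [cite: Andre1996Motifs, Thm. 0.5 (p. 8) and §6.3 Remarque 2 (p. 33)] [cite: Abdulali1994FamiliesAV, (1.1) (p. 1122)] -/
theorem compactAbelianPencilVHC_of_motivatedImpliesAlgebraicAV (h : MotivatedImpliesAlgebraicAV) :
    Ring2.Deform.CompactAbelianPencilVHC :=
  fun _ _ _ _ hf p W _ h₀ s => by
    obtain ⟨s₀, hs₀⟩ := h₀
    exact compactPencil_map_fiberι_mem_algebraicClasses_of_motivatedImpliesAlgebraicAV h hf p W hs₀ s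

/-- **(V6a″) `MotivatedImpliesAlgebraicAV ⟹ HC_CM` modulo Lemmes 6.3.2–6.3.3 (c12) only** ((V3″) and the deform seat's
(D′) `Ring2.Deform.HC_CM_of_andre1996_of_compactAbelianPencilVHC`); `HC_CM` a CONCLUSION here.
[cite: Andre1996Motifs, Lemmes 6.3.2–6.3.3 and Remarque 2 (pp. 32–33)] -/
theorem hc_cm_of_motivatedImpliesAlgebraicAV_of_andre1996
    (h₂₂ : andre1996_cmHodgeClasses_algebraicallyAnchoredPencils) (h : MotivatedImpliesAlgebraicAV) :
    Theses.RankFourFaces.CMAbelianHodge :=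
  Ring2.Deform.HC_CM_of_andre1996_of_compactAbelianPencilVHC h₂₂ (compactAbelianPencilVHC_of_motivatedImpliesAlgebraicAV h)

/-- **(V6b″) `MotivatedImpliesAlgebraicAV ⟹ HC_AV` modulo Lemmes 6.3.1–6.3.3 (c11, c12) only** ((V3″) and the deform
seat's (M′) `Ring2.Deform.HC_AV_of_andre1996_of_compactAbelianPencilVHC`). Compare the dictionary's
`hc_av_of_andre_of_motivatedImpliesAlgebraicAV` (modulo c2) and gen 30's (V6b) (modulo c24, c11, c12).
[cite: Andre1996Motifs, §6.3 (pp. 31–33)] [cite: Milne2020HodgeClassesAV, Rem. 2–3] -/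
theorem hc_av_of_motivatedImpliesAlgebraicAV_of_andre1996 (h₂₁ : andre1996_cmAnchoredPencil)
    (h₂₂ : andre1996_cmHodgeClasses_algebraicallyAnchoredPencils) (h : MotivatedImpliesAlgebraicAV) :
    Theses.PadicSemiregularLift.HodgeAbelianVarieties :=
  Ring2.Deform.HC_AV_of_andre1996_of_compactAbelianPencilVHC h₂₁ h₂₂
    (compactAbelianPencilVHC_of_motivatedImpliesAlgebraicAV h)

/-- **(V6c″) `MotivatedImpliesAlgebraicAV ⟹ AbelianSchemeVHC` (row b05 ⟹ row b02) modulo {c11, c12}**, through `HC_AV`.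
[cite: Andre1996Motifs, §6.3 Remarque 2 (p. 33)] [cite: CharlesSchnell2014Notes, Cor. 11.3.6] -/
theorem abelianSchemeVHC_of_motivatedImpliesAlgebraicAV_of_andre1996 (h₂₁ : andre1996_cmAnchoredPencil)
    (h₂₂ : andre1996_cmHodgeClasses_algebraicallyAnchoredPencils) (h : MotivatedImpliesAlgebraicAV) :
    AbelianSchemeVHC :=
  abelianSchemeVHC_of_hc_av (hc_av_of_motivatedImpliesAlgebraicAV_of_andre1996 h₂₁ h₂₂ h)

/-- **(V6d″) EXACTNESS `HC_AV ↔ MotivatedImpliesAlgebraicAV` modulo Lemmes 6.3.1–6.3.3 (c11, c12) ONLY** — the stage-3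
dictionary cell «row b05 ≡ `HC_AV`» with the two pencil-existence lemmas as its whole modulus (`⟹` is the DISCHARGED
on-path lemma `motivatedImpliesAlgebraicAV_of_hc_av_holds`). Earlier moduli: {c2} (dictionary), {c24, c11, c12} (gen 30),
{c17, c11, c12} (gen 36). [cite: Andre1996Motifs, Thm. 0.6.2 (p. 9), §2.5 c) and §6.3 (pp. 31–33)] -/
theorem hc_av_iff_motivatedImpliesAlgebraicAV_of_andre1996 (h₂₁ : andre1996_cmAnchoredPencil)
    (h₂₂ : andre1996_cmHodgeClasses_algebraicallyAnchoredPencils) :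
    Theses.PadicSemiregularLift.HodgeAbelianVarieties ↔ MotivatedImpliesAlgebraicAV :=
  ⟨motivatedImpliesAlgebraicAV_of_hc_av_holds, hc_av_of_motivatedImpliesAlgebraicAV_of_andre1996 h₂₁ h₂₂⟩

/-- **(V6d′″) EXACTNESS `MotivatedImpliesAlgebraicAV ↔ CompactAbelianPencilVHC` modulo {c11, c12}** (`⟹` fact-free,
(V3″); `⟸` through `HC_AV`). [cite: Andre1996Motifs, §6.3 Remarque 2 (p. 33)] -/
theorem motivatedImpliesAlgebraicAV_iff_compactAbelianPencilVHC_of_andre1996 (h₂₁ : andre1996_cmAnchoredPencil)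
    (h₂₂ : andre1996_cmHodgeClasses_algebraicallyAnchoredPencils) :
    MotivatedImpliesAlgebraicAV ↔ Ring2.Deform.CompactAbelianPencilVHC :=
  ⟨compactAbelianPencilVHC_of_motivatedImpliesAlgebraicAV, fun hV =>
    motivatedImpliesAlgebraicAV_of_hc_av_holds (Ring2.Deform.HC_AV_of_andre1996_of_compactAbelianPencilVHC h₂₁ h₂₂ hV)⟩

/-! ## §4 The cell row, `HC_CM` load-bearing, modulo Lemme 6.3.1 alone -/

/-- **(V9″) `HC_CM ∧ MotivatedImpliesAlgebraicAV ⟹ HC_AV` MODULO LEMME 6.3.1 (c11) ALONE** — gen 30's (V9) (modulo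
{c24, c11}) / gen 36's (V9′) (modulo {c17, c11}) with the deformation binder deleted: (V3″) and the deform seat's row V′
`Ring2.Deform.HC_AV_of_andre1996_of_HC_CM_of_compactAbelianPencilVHC`. `HC_CM` (by name) is LOAD-BEARING here (it replaces
Lemmes 6.3.2–6.3.3 at the CM anchors). research route conditional on HC_CM; not a corollary; Q11.4-sentence-2 already
refuted in dim ≥ 3. [cite: Andre1996Motifs, Thm. 0.5, Lemme 6.3.1 and §6.3 a) (pp. 8, 31–33)]
[cite: Abdulali1994FamiliesAV, Lemma 6.2 (p. 1131)] -/
theorem hc_av_of_hc_cm_of_motivatedImpliesAlgebraicAV_of_andre1996 (hCM : Theses.RankFourFaces.CMAbelianHodge)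
    (h₂₁ : andre1996_cmAnchoredPencil) (h : MotivatedImpliesAlgebraicAV) :
    Theses.PadicSemiregularLift.HodgeAbelianVarieties :=
  Ring2.Deform.HC_AV_of_andre1996_of_HC_CM_of_compactAbelianPencilVHC h₂₁ hCM
    (compactAbelianPencilVHC_of_motivatedImpliesAlgebraicAV h)

end Summit.HodgeConjecture.HodgeConjecture.Ring2.Hypotheses

end
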